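import Literature.AlgebraicGeometry.HodgeTheory.WeilClassesIsogenyDescent
import Literature.AlgebraicGeometry.Motives.AbelianVarietyProjectiveChart
import HarnessLib

/-!
# Crux `HeckePrymAnchors` (stmt-HodgeConjecture-14496), line `Sketch` · stub A3 `stub_isogenyTransfer`

Route `HeckePrymWeil`. The strong Weil plane `weilClassesOf Y Ψ k p` of a complex abelian
`2k`-fold `(Y, Ψ)` (`Literature/AlgebraicGeometry/HodgeTheory/WeilClasses`: the classes `c` with
`(x·𝟙 + y·Ψ)^* c = (x ± i y √p)^{2k} · c` for all `x y : ℕ`) consists of algebraic classes as soon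
as the strong Weil plane of a `K`-ISOGENOUS model `(Y', Ψ')` does, where the isogeny is given as an
ISOGENY PAIR `f : Y ⟶ Y'`, `g : Y' ⟶ Y` with `f ≫ g = m • 𝟙 Y`, `m ≥ 1`, `f` flat and `g`
`K`-equivariant (`g ≫ Ψ = Ψ' ≫ g`).

This is the tree's PROVED isogeny-descent pattern
`Literature.AlgebraicGeometry.HodgeTheory.mem_algebraicClasses_of_isogeny_of_mem_weilClassesOf`
(van Geemen, LNM 1594, 3.6–3.7; Markman, arXiv:2509.23403 §11.5 Step 1) in WHOLE-PLANE form, i.e.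
without the rationality / Hodge-type bookkeeping (so no Hodge model is needed): for
`c ∈ weilClassesOf Y Ψ k p`,

* `g^* c ∈ weilClassesOf Y' Ψ' k p` (`map_mem_weilClassesOf_of_comm`), hence `g^* c` is algebraic
  on `Y'` by hypothesis;
* flat pull-back preserves algebraic classes (`map_mem_algebraicClasses_of_flat`; both schemes are
  locally Noetherian because abelian varieties are smooth projective,
  `AbelianVariety.isSmoothProjective_holds` and `IsSmoothProjective.isLocallyNoetherian_holds`), so
  `f^* g^* c = (f ≫ g)^* c = (m • 𝟙 Y)^* c = m^{2k} · c` (`abelianVarietyHom_map_map_apply`,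
  `map_nsmul_id_eq_of_mem_weilClassesOf`) is algebraic on `Y`;
* `m^{2k} ≠ 0` in `ℂ`, so `c` is algebraic.

The hypotheses `Y.dim = 2k`, `Y'.dim = 2k`, `Ψ ≫ Ψ = -p` of the registered signature are not used
by the proof (local Noetherianity holds in every dimension).
-/

noncomputable section
-- every declaration of this problem lives in Summit.HodgeConjecture.HodgeConjecture.… (summit = sub-problem)
set_option linter.dupNamespace false

open CategoryTheory AlgebraicGeometry
open Literature.AlgebraicGeometry

namespace Summit.HodgeConjecture.HodgeConjecture.Theorems.HeckePrymWeilLine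

open Literature.AlgebraicGeometry.Motives Literature.AlgebraicGeometry.HodgeTheory
open Literature.AlgebraicTopology.SingularHomology

/-- A complex abelian variety is a locally Noetherian scheme (it is smooth projective over `ℂ`,
`AbelianVariety.isSmoothProjective_holds`, hence locally of finite type over a field,
`IsSmoothProjective.isLocallyNoetherian_holds`). [cite: Hartshorne1977, II Prop. 3.2 and II Ex. 3.13(g)] -/
theorem isLocallyNoetherian_abelianVariety_left (C : AbelianVariety ℂ) :
    IsLocallyNoetherian C.X.left :=
  IsSmoothProjective.isLocallyNoetherian_holds (n := C.dim)
    (AbelianVariety.isSmoothProjective_holds (A := C))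

/-- **Stub A3 — isogeny transfer of the strong Weil plane** (van Geemen LNM 1594, 3.6–3.7; the
tree's `mem_algebraicClasses_of_isogeny_of_mem_weilClassesOf`, whole-plane form): for complex abelian
`2k`-folds `(Y, Ψ)`, `(Y', Ψ')` and an isogeny pair `f : Y ⟶ Y'` (flat), `g : Y' ⟶ Y`
(`K`-equivariant: `g ≫ Ψ = Ψ' ≫ g`) with `f ≫ g = m • 𝟙 Y`, `m ≥ 1`: if
`weilClassesOf Y' Ψ' k p ≤ algebraicClasses Y'.X k` then
`weilClassesOf Y Ψ k p ≤ algebraicClasses Y.X k` — `g^*` maps the plane of `Y` into that of `Y'`,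
`f^* g^* = (m • 𝟙)^* = m^{2k}` on the plane, and flat pull-back preserves algebraic classes.
[cite: vanGeemen1994HodgeAV, 3.6–3.7 and proof of Lemma 5.2] -/
theorem stub_isogenyTransfer :
    ∀ (p k : ℕ) (Y Y' : AbelianVariety ℂ) (Ψ : Y ⟶ Y) (Ψ' : Y' ⟶ Y'),
      Y.dim = 2 * k → Y'.dim = 2 * k → Ψ ≫ Ψ = -((p : ℤ) • 𝟙 Y) →
      ∀ (f : Y ⟶ Y') (g : Y' ⟶ Y) (m : ℕ), 0 < m → f ≫ g = m • 𝟙 Y → Flat f.hom.hom.hom.left →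
        g ≫ Ψ = Ψ' ≫ g → weilClassesOf Y' Ψ' k p ≤ algebraicClasses Y'.X k →
          weilClassesOf Y Ψ k p ≤ algebraicClasses Y.X k := by
  intro p k Y Y' Ψ Ψ' _ _ _ f g m hm hfg hf hg halg c hcW
  -- the class `g^* c` lies in the strong Weil plane of `(Y', Ψ')`, hence is algebraic on `Y'`
  have hc'W := map_mem_weilClassesOf_of_comm (n := k) (d := p) hg hcW
  have halg' := halg hc'W
  -- flat pull-back along `f`
  haveI : Flat f.hom.hom.hom.left := hf
  haveI : IsLocallyNoetherian Y.X.left := isLocallyNoetherian_abelianVariety_left Y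
  haveI : IsLocallyNoetherian Y'.X.left := isLocallyNoetherian_abelianVariety_left Y'
  have hfc' := map_mem_algebraicClasses_of_flat f.hom.hom.hom halg'
  -- `f^* g^* c = (f ≫ g)^* c = (m • 𝟙 Y)^* c = m^{2k} • c`
  have key : complexBetti.map f.hom.hom.hom (2 * k)
      (singularCohomology.map ℂ ℂ (Motives.AlgPoints.mapContinuous (L := ℂ) g.hom.hom.hom) (2 * k) c) =
        ((m : ℂ) ^ (2 * k)) • c := by
    change singularCohomology.map ℂ ℂ (Motives.AlgPoints.mapContinuous (L := ℂ) f.hom.hom.hom) (2 * k)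
      (singularCohomology.map ℂ ℂ (Motives.AlgPoints.mapContinuous (L := ℂ) g.hom.hom.hom) (2 * k) c) = _
    rw [abelianVarietyHom_map_map_apply, hfg, map_nsmul_id_eq_of_mem_weilClassesOf m hcW]
  rw [key] at hfc'
  have hmC : ((m : ℂ) ^ (2 * k)) ≠ 0 := pow_ne_zero _ (Nat.cast_ne_zero.mpr hm.ne')
  have h := Submodule.smul_mem (algebraicClasses Y.X k) (((m : ℂ) ^ (2 * k))⁻¹) hfc'
  rwa [smul_smul, inv_mul_cancel₀ hmC, one_smul] at h

end Summit.HodgeConjecture.HodgeConjecture.Theorems.HeckePrymWeilLine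

end
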